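import Mathlib
import Summits.Ventures.PercRepro2.Defs
import Summits.Ventures.PercRepro2.Independence
import Summits.Ventures.PercRepro2.Harris
import Summits.Ventures.PercRepro2.Graph
import Summits.Ventures.PercRepro2.Exploration
import Summits.Ventures.PercRepro2.Events
import Summits.Ventures.PercRepro2.HCov
import Summits.Ventures.PercRepro2.HCovFns
import Summits.Ventures.PercRepro2.HCovSwap
import Summits.Ventures.PercRepro2.PendantRoot
import Summits.Ventures.PercRepro2.PendantO
import Summits.Ventures.PercRepro2.PendantB
import Summits.Ventures.PercRepro2.PendantBRow
import Summits.Ventures.PercRepro2.LeafStep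
import Summits.Ventures.PercRepro2.LeafStepT0
import Summits.Ventures.PercRepro2.LeafPlus
import Summits.Ventures.PercRepro2.VdBKahn

/-!
# The two-copy Bernstein pieces of the leaf expansion and the three-copy form of (Q1)
(blind cell PercRepro2, p1 g9; `proofs/P1-Q1CORE.md` §1)

`Gc` is a sum of products of three `Q`-masses (copies `A`, `B`, `C`: the `P(Q)`/`gap` copy, the
`PD`-copy carrying `D, D_o`, and the moment copy). For `a₃` a leaf at `v` with weight `q`, copy `A`
never sees the leaf, so the leaf expansion `Gc(q) = (1−q)² T₀ + 2q(1−q) R½ + q² Gc(v)`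
(`LeafStep.Gc_leaf`) is the TWO-copy Bernstein expansion in the leaf states of copies `B`, `C`:

* `MB` = the piece with the leaf open in copy `B` only (`Gc(v)` with the moment copy `a₃`-free),
* `MC` = the piece with the leaf open in copy `C` only (`Gc(v)` with the `PD`-copy unrestricted:
  `D ↦ P(Q)`, `D_o ↦ P(Q, o ∈ U)`),

and **`2 · R½ = MB + MC`** (`two_Rhalf_eq`). The `B`-piece is explicit: **`MB = (D_v / P(Q)) · T₀ − m_b · CovC(o, v)`**
(`MB_eq`, cleared by `P(Q)`; `D_v = P(Q, v ∉ U)`, `m_b = P(Q, b ∈ U)`) — the `PD`-copy with `a₃ = v` loses exactly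
`m_b · CovC(o, v)` against the scaled `a₃`-free copy. Hence the pole identity becomes

  **`P(Q)² · Gc(v) + CovC(o, v) · T₀(b, v) = P(Q) · D_v · (MC − m_b · CovC(o, v))`**   (`Q1_eq_MC`)

and **(Q1) at `v` ⟺ `m_b · CovC(o, v) ≤ MC`** whenever `D_v > 0` (`Q1Row_iff_MC`): the row is the
statement that the moment copy's Bernstein piece pays for the `PD`-copy's deficit. Normalised by
`P(Q)³`, `MC/P³ = Cov_Q(σ_b, σ_o + σ_v(ū_o − u_o)) − Cov_Q((1 − u_v) u_b, u_o)`, so (Q1) reads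
`Cov_Q(σ_b, σ_o + σ_v(ū_o − u_o)) ≥ Cov_Q(u_o, u_b (1 − u_v) + ū_b u_v)` — (HCOV) at `a₃ := v`
with the `PD`-conditioning removed (`γ ↦ ū_o`, `d·Cov_PD ↦ Cov_Q`).

Consequences recorded here: (Q1) follows from (HCOV) at `v` whenever `CovC(o, v) ≥ 0`
(`Q1Row_of_HCov_of_covC_nonneg`), and `CovC(o, v) ≥ 0` holds on the (A3-O)-type instances
(`{o ∈ U} ⊆ {v ∈ U}` on `Q`: `covC_nonneg_of_subset`) and on the (ONE-ROOT)-type instances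
(`o, v` never in `C(a₁)` on `Q`: `covC_nonneg_of_oneRoot`, by van den Berg–Kahn 1.1 for the
`a₂`-cluster avoiding `a₁`). The remaining content of (Q1) off the equality locus of (HCOV) is
the quantitative margin on the instances with `CovC(o, v) < 0` (`proofs/P1-Q1CORE.md` §2–§3).
-/

namespace Summit.Ventures.PercRepro2

open UnionCluster CovForm PendantRoot PendantO

namespace LeafStep

variable {V : Type*} {E : Type*} [Fintype E] [DecidableEq E] [Fintype V] [DecidableEq V]
  {R : Type*} [Field R] [LinearOrder R] [IsStrictOrderedRing R]

section Defs

variable (p : E → R) (ends : E → Sym2 V)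

/-- **`MB`**: the Bernstein piece of the leaf expansion with the leaf open in the `PD`-copy only —
`Gc(o, b, a₃ := v)` with the moment copy `a₃`-free (`E_Q[σ₃ ·] ↦ 0`, `P(PD, b ∈ U) ↦ P(Q, b ∈ U)`,
`P(PD, b ∈ U, o ∈ U) ↦ P(Q, o ∈ U, b ∈ U)`). -/
noncomputable def MB (o a₁ a₂ v b : V) : R :=
  prob p (avoidAll ends a₂ {a₁}) * (prob p (PDEvent ends a₁ a₂ v) * EQbo p ends o a₁ a₂ b) +
    gap p ends a₁ a₂ b * (prob p (PDEvent ends a₁ a₂ v) * EQo p ends o a₁ a₂) +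
    prob p (avoidAll ends a₂ {a₁}) *
      (Do p ends o a₁ a₂ v * mU p ends a₁ a₂ b -
        prob p (PDEvent ends a₁ a₂ v) * mUU p ends o a₁ a₂ b)

/-- **`MC`**: the Bernstein piece of the leaf expansion with the leaf open in the moment copy only —
`Gc(o, b, a₃ := v)` with the `PD`-copy unrestricted (`D ↦ P(Q)`, `D_o ↦ P(Q, o ∈ U)`). -/
noncomputable def MC (o a₁ a₂ v b : V) : R :=
  prob p (avoidAll ends a₂ {a₁}) *
      (prob p (avoidAll ends a₂ {a₁}) * EQbo p ends o a₁ a₂ b +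
        mU p ends a₁ a₂ o * EQb3 p ends a₁ a₂ v b -
        prob p (avoidAll ends a₂ {a₁}) * EQb3o p ends o a₁ a₂ v b) +
    gap p ends a₁ a₂ b *
      (prob p (avoidAll ends a₂ {a₁}) * EQo p ends o a₁ a₂ +
        mU p ends a₁ a₂ o * EQ3 p ends a₁ a₂ v -
        prob p (avoidAll ends a₂ {a₁}) * EQ3o p ends o a₁ a₂ v) +
    prob p (avoidAll ends a₂ {a₁}) *
      (mU p ends a₁ a₂ o * PDb p ends a₁ a₂ v b -
        prob p (avoidAll ends a₂ {a₁}) * PDbo p ends o a₁ a₂ v b)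

end Defs

/-! ## The identities -/

section Identity

variable (p : E → R) (ends : E → Sym2 V)

omit [Fintype V] in
/-- **`2 · R½ = MB + MC`**: the middle coefficient of the leaf expansion is the sum of the two
one-copy Bernstein pieces. -/
theorem two_Rhalf_eq (o a₁ a₂ v b : V) :
    2 * Rhalf p ends o a₁ a₂ v b = MB p ends o a₁ a₂ v b + MC p ends o a₁ a₂ v b := by
  unfold Rhalf T0 Gc1 MB MC mU mUU
  unfold EQbo EQb3 EQb3o EQo EQ3 EQ3o PDb PDbo Do
  rw [gap_eq_Q p ends a₁ a₂ b]
  simp only [prob_PD_v p ends a₁ a₂ v, prob_T_v p ends a₁ a₂ v, prob_T'_v p ends a₁ a₂ v,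
    prob_PD_inter_v p ends a₁ a₂ v, prob_T_inter_v p ends a₁ a₂ v, prob_T'_inter_v p ends a₁ a₂ v]
  simp only [Set.inter_comm, Set.inter_left_comm]
  ring

omit [Fintype V] in
/-- **`P(Q) · MB = D_v · T₀ − P(Q) · m_b · CovC(o, v)`**, i.e. `MB = (D_v/P(Q)) · T₀ − m_b · CovC(o, v)`:
the `PD`-copy's deficit against the scaled `a₃`-free piece is exactly `m_b · CovC(o, v)`. -/
theorem MB_eq (o a₁ a₂ v b : V) :
    prob p (avoidAll ends a₂ {a₁}) * MB p ends o a₁ a₂ v b =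
      prob p (PDEvent ends a₁ a₂ v) * T0 p ends o a₁ a₂ b -
        prob p (avoidAll ends a₂ {a₁}) * (mU p ends a₁ a₂ b * covC p ends o a₁ a₂ v) := by
  unfold MB T0 covC mU mUU
  unfold EQbo EQo Do
  rw [gap_eq_Q p ends a₁ a₂ b]
  simp only [prob_PD_v p ends a₁ a₂ v, prob_PD_inter_v p ends a₁ a₂ v]
  simp only [Set.inter_comm]
  ring

omit [Fintype V] in
/-- **The three-copy form of (Q1)**:
`P(Q)² · Gc(v) + CovC(o, v) · T₀(b, v) = P(Q) · D_v · (MC − m_b · CovC(o, v))`. -/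
theorem Q1_eq_MC (o a₁ a₂ v b : V) :
    prob p (avoidAll ends a₂ {a₁}) ^ 2 * Gc p ends o a₁ a₂ v b +
        covC p ends o a₁ a₂ v * T0 p ends b a₁ a₂ v =
      prob p (avoidAll ends a₂ {a₁}) * prob p (PDEvent ends a₁ a₂ v) *
        (MC p ends o a₁ a₂ v b - mU p ends a₁ a₂ b * covC p ends o a₁ a₂ v) := by
  unfold MC T0 covC mU mUU
  unfold Gc DEF EQbo EQb3 EQb3o EQo EQ3 EQ3o PDb PDbo Do
  rw [gap_eq_Q p ends a₁ a₂ b, gap_eq_Q p ends a₁ a₂ v]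
  simp only [prob_PD_v p ends a₁ a₂ v, prob_T_v p ends a₁ a₂ v, prob_T'_v p ends a₁ a₂ v,
    prob_PD_inter_v p ends a₁ a₂ v, prob_T_inter_v p ends a₁ a₂ v, prob_T'_inter_v p ends a₁ a₂ v]
  simp only [Set.inter_comm, Set.inter_left_comm]
  ring

end Identity

/-! ## (Q1) as a statement about the moment copy -/

section Row

variable (p : E → R) (ends : E → Sym2 V)

omit [Fintype E] [DecidableEq E] [Fintype V] in
/-- `PD_v ⊆ Q`. -/
lemma PDEvent_subset_Q (a₁ a₂ v : V) :
    PDEvent ends a₁ a₂ v ⊆ avoidAll ends a₂ {a₁} := by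
  intro ω hω
  rw [ISplit.PD_eq_R_inter] at hω
  have hR := hω.1
  rw [ZOloc.R_eq_Q_inter] at hR
  exact hR.1

omit [Fintype V] in
/-- **(Q1) at `v` ⟺ `m_b · CovC(o, v) ≤ MC`** whenever `D_v > 0`. -/
theorem Q1Row_iff_MC (hp : IsProbVec p) (o a₁ a₂ v b : V)
    (hD : 0 < prob p (PDEvent ends a₁ a₂ v)) :
    Q1Row p ends o a₁ a₂ v b ↔
      mU p ends a₁ a₂ b * covC p ends o a₁ a₂ v ≤ MC p ends o a₁ a₂ v b := by
  have hP : 0 < prob p (avoidAll ends a₂ {a₁}) :=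
    lt_of_lt_of_le hD (prob_mono hp (PDEvent_subset_Q ends a₁ a₂ v))
  have hpos : 0 < prob p (avoidAll ends a₂ {a₁}) * prob p (PDEvent ends a₁ a₂ v) := by
    positivity
  unfold Q1Row
  rw [Q1_eq_MC, mul_nonneg_iff_of_pos_left hpos, sub_nonneg]

/-- (Q1) at `v` follows from (HCOV) at `v` whenever `CovC(o, v) ≥ 0` (the margin is then a
nonnegative multiple of `T₀(b, v) ≥ 0`). -/
theorem Q1Row_of_HCov_of_covC_nonneg (hp : IsProbVec p) (o a₁ a₂ v b : V)
    (hc : 0 ≤ covC p ends o a₁ a₂ v) (h : HCov p ends o a₁ a₂ v b) :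
    Q1Row p ends o a₁ a₂ v b := by
  unfold Q1Row
  have hT := T0_nonneg p ends hp b a₁ a₂ v
  have h1 : 0 ≤ prob p (avoidAll ends a₂ {a₁}) ^ 2 * Gc p ends o a₁ a₂ v b :=
    mul_nonneg (sq_nonneg _) h
  have h2 : 0 ≤ covC p ends o a₁ a₂ v * T0 p ends b a₁ a₂ v := mul_nonneg hc hT
  linarith

end Row

/-! ## Two classes with `CovC(o, v) ≥ 0` -/

section Classes

variable (p : E → R) (ends : E → Sym2 V)

omit [Fintype E] [DecidableEq E] [Fintype V] [DecidableEq V] in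
/-- On `Q = {a₂ ↮ a₁}` no vertex lies in both root clusters. -/
lemma not_conn_both_of_mem_Q {ω : Config E} {a₁ a₂ v : V} (hQ : ω ∈ avoidAll ends a₂ {a₁})
    (h1 : ω ∈ connEvent ends a₁ v) (h2 : ω ∈ connEvent ends a₂ v) : False :=
  hQ a₁ (Finset.mem_singleton_self a₁) (conn_trans h2 (conn_symm h1))

omit [Fintype V] in
/-- `m_U(v) ≤ P(Q)`: the two root-cluster memberships are disjoint on `Q`. -/
lemma mU_le_prob_Q (hp : IsProbVec p) (a₁ a₂ v : V) :
    mU p ends a₁ a₂ v ≤ prob p (avoidAll ends a₂ {a₁}) := by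
  have h := prob_PD_v p ends a₁ a₂ v
  have h0 := prob_nonneg hp (PDEvent ends a₁ a₂ v)
  unfold mU
  linarith

omit [Fintype V] in
/-- **(A3-O)-type instances**: if on `Q` every configuration with `o ∈ U` has `v ∈ U` (e.g. every
path from `o` to a root passes through `v`), then `CovC(o, v) = m_o · D_v ≥ 0`. -/
theorem covC_nonneg_of_subset (hp : IsProbVec p) (o a₁ a₂ v : V)
    (h : avoidAll ends a₂ {a₁} ∩ (connEvent ends a₁ o ∪ connEvent ends a₂ o) ⊆
      connEvent ends a₁ v ∪ connEvent ends a₂ v) :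
    0 ≤ covC p ends o a₁ a₂ v := by
  -- `mUU o v = m_o` under the hypothesis, so `CovC = m_o · (P(Q) − m_v) = m_o · D_v`.
  have key : mUU p ends o a₁ a₂ v = mU p ends a₁ a₂ o := by
    unfold mUU mU
    -- split `Q ∩ {o ∈ C₁}` and `Q ∩ {o ∈ C₂}` by the (disjoint on `Q`) membership of `v`
    have e1 : prob p (avoidAll ends a₂ {a₁} ∩ connEvent ends a₁ o) =
        prob p (avoidAll ends a₂ {a₁} ∩ (connEvent ends a₁ o ∩ connEvent ends a₁ v)) +
          prob p (avoidAll ends a₂ {a₁} ∩ (connEvent ends a₁ o ∩ connEvent ends a₂ v)) := by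
      rw [← prob_union_of_disjoint]
      · congr 1
        ext ω
        constructor
        · rintro ⟨hQ, ho⟩
          have hv := h ⟨hQ, Or.inl ho⟩
          rcases hv with hv | hv
          · exact Or.inl ⟨hQ, ho, hv⟩
          · exact Or.inr ⟨hQ, ho, hv⟩
        · rintro (⟨hQ, ho, _⟩ | ⟨hQ, ho, _⟩) <;> exact ⟨hQ, ho⟩
      · rw [Set.disjoint_left]
        rintro ω ⟨hQ, _, hv1⟩ ⟨_, _, hv2⟩
        exact not_conn_both_of_mem_Q ends hQ hv1 hv2
    have e2 : prob p (avoidAll ends a₂ {a₁} ∩ connEvent ends a₂ o) =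
        prob p (avoidAll ends a₂ {a₁} ∩ (connEvent ends a₂ o ∩ connEvent ends a₂ v)) +
          prob p (avoidAll ends a₂ {a₁} ∩ (connEvent ends a₂ o ∩ connEvent ends a₁ v)) := by
      rw [← prob_union_of_disjoint]
      · congr 1
        ext ω
        constructor
        · rintro ⟨hQ, ho⟩
          have hv := h ⟨hQ, Or.inr ho⟩
          rcases hv with hv | hv
          · exact Or.inr ⟨hQ, ho, hv⟩
          · exact Or.inl ⟨hQ, ho, hv⟩
        · rintro (⟨hQ, ho, _⟩ | ⟨hQ, ho, _⟩) <;> exact ⟨hQ, ho⟩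
      · rw [Set.disjoint_left]
        rintro ω ⟨hQ, _, hv2⟩ ⟨_, _, hv1⟩
        exact not_conn_both_of_mem_Q ends hQ hv1 hv2
    rw [e1, e2]
    ring
  unfold covC
  rw [key]
  have hD := mU_le_prob_Q p ends hp a₁ a₂ v
  have hmo : 0 ≤ mU p ends a₁ a₂ o := by
    unfold mU
    exact add_nonneg (prob_nonneg hp _) (prob_nonneg hp _)
  nlinarith

/-- **(ONE-ROOT)-type instances**: if on `Q` neither `o` nor `v` ever lies in `C(a₁)` (e.g. `a₂`
separates `a₁` from `{o, v}`), then `CovC(o, v) ≥ 0` is van den Berg–Kahn 1.1 for the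
`a₂`-cluster conditioned on avoiding `a₁`. -/
theorem covC_nonneg_of_oneRoot (hp : IsProbVec p) (o a₁ a₂ v : V)
    (ho : prob p (avoidAll ends a₂ {a₁} ∩ connEvent ends a₁ o) = 0)
    (hv : prob p (avoidAll ends a₂ {a₁} ∩ connEvent ends a₁ v) = 0) :
    0 ≤ covC p ends o a₁ a₂ v := by
  have eQ : avoidAll ends a₂ {a₁} = (connEvent ends a₂ a₁)ᶜ := by
    ext ω; simp [avoidAll]
  -- the three cross terms of `mUU o v` vanish
  have z1 : prob p (avoidAll ends a₂ {a₁} ∩ (connEvent ends a₁ o ∩ connEvent ends a₁ v)) = 0 :=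
    le_antisymm (ho ▸ prob_mono hp (Set.inter_subset_inter_right _ Set.inter_subset_left))
      (prob_nonneg hp _)
  have z2 : prob p (avoidAll ends a₂ {a₁} ∩ (connEvent ends a₂ o ∩ connEvent ends a₁ v)) = 0 :=
    le_antisymm (hv ▸ prob_mono hp (Set.inter_subset_inter_right _ Set.inter_subset_right))
      (prob_nonneg hp _)
  have z3 : prob p (avoidAll ends a₂ {a₁} ∩ (connEvent ends a₁ o ∩ connEvent ends a₂ v)) = 0 :=
    le_antisymm (ho ▸ prob_mono hp (Set.inter_subset_inter_right _ Set.inter_subset_left))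
      (prob_nonneg hp _)
  have hpair := vdBK_pair p hp ends a₂ o v a₁
  unfold covC mUU mU
  rw [ho, hv, z1, z2, z3, eQ]
  simp only [Set.inter_comm, Set.inter_left_comm] at hpair ⊢
  linarith

end Classes

end LeafStep

end Summit.Ventures.PercRepro2
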